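import Summits.BirchSwinnertonDyer.BirchSwinnertonDyer.Theorems.AdditiveBranchIMCTwistRootNumberTwistedKroneckerAnyTwo
import HarnessLib

/-!
# The root number of an ODD, GOOD-PRIME quadratic twist of a curve with ANY twist-type reduction at `2` — Kronecker form WITHOUT a
# potentially multiplicative prime inside the twist (door D «`ℓ₀ = 2`» groundwork of crux 19357 `three_field_road`, LeadReport27 §5 items 2–3;
# LEAD cruxlead-19357 g18, `--supports` 19357, helper only)

Theorems only. The any-two Kronecker engine `rootNumber_quadraticTwist_eq_of_potMult_kronecker_anyTwo` (p816093) carries an odd potentially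
multiplicative prime `ℓ₀` INSIDE the twist parameter `D = ℓ₀*·m` (the twisted Wan prime of E3′). At door D the twisted Wan prime is `2` and every
twist the road performs is by an ODD parameter supported on GOOD primes — `E^{(d_K)} ≅ W₁^{(m)}` with `m` the odd part of `d_K`, and design D2's auxiliary
twist `V^{(m′)}` —, so the engine needed is the same computation WITHOUT `ℓ₀`: for `D ≡ 1 (mod 4)` square-free with every prime of `D` a good prime,

  `w(E^{(D)}) = χ₄(|D|) · (∏_{r ∥ N_E} k_r(D)) · w(E)`,  `k_2 = χ₈(D)`, `k_r = (D/r)` at odd `r`,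

for `E` with odd additive primes of twist type and ANY twist-type reduction at `2` (`λ₂(f_{E^{(D)}}) = λ₂(f_E)` at an additive twist-type `2`, p815990;
`w₂` Kronecker flip at a multiplicative `2`, p812641). Proof: p816093's with the `ℓ₀` bookkeeping deleted.

* `rootNumber_quadraticTwist_eq_of_good_kronecker_anyTwo`.

BSD is proved for no curve. [AtkinLi1978] §3; [Rohrlich1993Compositio] Prop. 2–3; [SilvermanAEC2009] X.5 Cor. 5.4, Ex. 10.16.
-/

set_option linter.dupNamespace false
set_option autoImplicit false

noncomputable section

open scoped MatrixGroups Classical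

open CongruenceSubgroup Literature.NumberTheory.EllipticCurves Literature.NumberTheory.EllipticCurves.ModularForms
  IsDedekindDomain IsDedekindDomain.HeightOneSpectrum NumberField Rat.HeightOneSpectrum WeierstrassCurve
  Summit.BirchSwinnertonDyer.Rank1Residual Summit.BirchSwinnertonDyer.BirchSwinnertonDyer.Theorems NumberTheorySymbols

namespace Summit.BirchSwinnertonDyer.BirchSwinnertonDyer.Theorems.TwistRootNumberTwisted

variable (W : WeierstrassCurve ℚ) [W.IsElliptic] [W.IsGloballyMinimal]

/-- **The root number of an odd good-prime twist, Kronecker form, any twist-type reduction at `2`** (module docstring):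
`w(E^{(D)}) = χ₄(|D|)·(∏_{r ∥ N_E} k_r(D))·w(E)` for `D ≡ 1 (mod 4)` square-free supported on good primes of `E`.
[cite: AtkinLi1978, §1 and §3] [cite: Rohrlich1993Compositio, Prop. 2 (ii)–(iii) and Prop. 3] [cite: SilvermanAEC2009, Ex. 10.16, App. A Prop. A.1.1 and X.5 Cor. 5.4] -/
theorem rootNumber_quadraticTwist_eq_of_good_kronecker_anyTwo (hmod : exists_isNewformOf)
    (htt : ∀ p : Nat.Primes, (p : ℕ) ≠ 2 → W.HasAdditiveReductionAt ((primesEquiv (R := ℤ)).symm p) →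
      ¬ (W.quadraticTwist (((-1 : ℤ) ^ ((p : ℕ) / 2) * p : ℤ) : ℚ)).HasAdditiveReductionAt
        ((primesEquiv (R := ℤ)).symm p))
    (h2tt : ∀ r : Nat.Primes, (r : ℕ) = 2 → W.HasAdditiveReductionAt ((primesEquiv (R := ℤ)).symm r) →
      ∃ t : ℤ, (t = -1 ∨ t = 2 ∨ t = -2) ∧ ¬ (W.quadraticTwist (t : ℚ)).HasAdditiveReductionAt ((primesEquiv (R := ℤ)).symm r))
    {D : ℤ} (hD4 : D % 4 = 1) (hmsq : Squarefree D)
    (hgood : ∀ r : Nat.Primes, ((r : ℕ) : ℤ) ∣ D → W.HasGoodReductionAt ((primesEquiv (R := ℤ)).symm r)) :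
    (W.quadraticTwist (D : ℚ)).rootNumber =
      ZMod.χ₄ (D.natAbs : ZMod 4) *
        (∏ r ∈ (W.conductorNorm ℤ).primeFactors,
          (if (W.conductorNorm ℤ).factorization r = 1 then (if r = 2 then ZMod.χ₈ (D : ZMod 8) else jacobiSym D r) else 1)) *
        W.rootNumber := by
  have hD0 : D ≠ 0 := by rintro rfl; norm_num at hD4
  have hDQ : (D : ℚ) ≠ 0 := by exact_mod_cast hD0
  set W' := W.quadraticTwist (D : ℚ) with hW'
  haveI : W'.IsElliptic := W.isElliptic_quadraticTwist hDQ
  set P2 : Nat.Primes := ⟨2, Nat.prime_two⟩ with hP2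
  set N := W.conductorNorm ℤ with hN
  set N' := W'.conductorNorm ℤ with hN'
  have hN0 : N ≠ 0 := (W.conductorNorm_pos_holds).ne'
  have hN'0 : N' ≠ 0 := (W'.conductorNorm_pos_holds).ne'
  have hM0 : D.natAbs ≠ 0 := Int.natAbs_ne_zero.mpr hD0
  haveI : NeZero (W.conductorNorm ℤ) := ⟨hN0⟩
  haveI : NeZero (W'.conductorNorm ℤ) := ⟨hN'0⟩
  have hMsq : Squarefree D.natAbs := Int.squarefree_natAbs.mpr hmsq
  have hDodd : ¬ (2 : ℤ) ∣ D := by omega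
  have hprime_m : ∀ r : Nat.Primes, ((r : ℕ) : ℤ) ∣ D → (r : ℕ) ≠ 2 ∧ ¬ (r : ℕ) ∣ N := by
    intro r hr
    refine ⟨fun h ↦ hDodd (by have h' := hr; rw [h] at h'; exact_mod_cast h'), fun hrN ↦ ?_⟩
    haveI := Fact.mk r.2
    exact ((W.dvd_conductorNorm_iff_not_hasGoodReductionAtPrime r).mp hrN)
      ((W.hasGoodReductionAtPrime_iff_hasGoodReductionAt_holds r).mpr (hgood r hr))
  have hbadN_not_dvd_D : ∀ r : Nat.Primes, (r : ℕ) ∣ N → ¬ ((r : ℕ) : ℤ) ∣ D := fun r hrN hrD ↦ (hprime_m r hrD).2 hrN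
  have hred : ∀ r : Nat.Primes, ¬ ((r : ℕ) : ℤ) ∣ D →
      (W'.HasGoodReductionAt ((primesEquiv (R := ℤ)).symm r) ↔ W.HasGoodReductionAt ((primesEquiv (R := ℤ)).symm r)) ∧
      (W'.HasMultiplicativeReductionAt ((primesEquiv (R := ℤ)).symm r) ↔ W.HasMultiplicativeReductionAt ((primesEquiv (R := ℤ)).symm r)) ∧
      (W'.HasAdditiveReductionAt ((primesEquiv (R := ℤ)).symm r) ↔ W.HasAdditiveReductionAt ((primesEquiv (R := ℤ)).symm r)) := by
    intro r hrD
    by_cases hr2 : (r : ℕ) = 2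
    · -- at `2` (ANY type): `f₂(E^{(D)}) = f₂(E)` for `D ≡ 1 (mod 4)`, and the type is read off `f₂`
      have hr : r = ⟨2, Nat.prime_two⟩ := Subtype.ext hr2
      subst hr
      have h := hasReductionAt_two_quadraticTwist_iff_of_emod_four_eq_one W hD4
      rw [← hW'] at h
      exact h
    · exact W.hasReductionAt_quadraticTwist_iff_of_not_dvd _ (by rw [Rat.natGenerator_primesEquiv_symm]; exact hr2)
        (by rw [Rat.natGenerator_primesEquiv_symm]; exact hrD)
  have hfac_eq : ∀ r : Nat.Primes, ¬ ((r : ℕ) : ℤ) ∣ D → N'.factorization r = N.factorization r := fun r hrD ↦ by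
    simpa only [Rat.natGenerator_primesEquiv_symm] using W.factorization_conductorNorm_quadraticTwist_eq_of_not_dvd hD4
      ((primesEquiv (R := ℤ)).symm r) (by rw [Rat.natGenerator_primesEquiv_symm]; exact hrD)
  have hadd_m : ∀ r : Nat.Primes, ((r : ℕ) : ℤ) ∣ D → W'.HasAdditiveReductionAt ((primesEquiv (R := ℤ)).symm r) := by
    intro r hr
    obtain ⟨hr2, -⟩ := hprime_m r hr
    have h2 : ¬ ((r : ℕ) : ℤ) ^ 2 ∣ D := by
      rintro ⟨w, hw⟩
      have hr2m : ((r : ℤ) * r) ∣ D := ⟨w, by rw [hw]; ring⟩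
      have hunit := hmsq (r : ℤ) hr2m
      rcases Int.isUnit_iff.mp hunit with h1 | h1
      · exact r.2.ne_one (by exact_mod_cast h1)
      · have : (0 : ℤ) ≤ (r : ℕ) := by positivity
        omega
    exact hasAdditiveReductionAt_quadraticTwist_of_good W hD0 r hr2 hr h2 (hgood r hr)
  have hsemi_m : ∀ r : Nat.Primes, ((r : ℕ) : ℤ) ∣ D →
      ¬ (W'.quadraticTwist (((-1 : ℤ) ^ ((r : ℕ) / 2) * r : ℤ) : ℚ)).HasAdditiveReductionAt ((primesEquiv (R := ℤ)).symm r) := by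
    intro r hr
    obtain ⟨hr2, -⟩ := hprime_m r hr
    obtain ⟨u, hu⟩ := hr
    have hDu : D = r * u := hu
    have hru : ¬ ((r : ℕ) : ℤ) ∣ u := by
      intro h'
      have hr2m : ((r : ℤ) * r) ∣ D := by rw [hu]; exact mul_dvd_mul_left _ h'
      have hunit := hmsq (r : ℤ) hr2m
      rcases Int.isUnit_iff.mp hunit with h1 | h1
      · exact r.2.ne_one (by exact_mod_cast h1)
      · have : (0 : ℤ) ≤ (r : ℕ) := by positivity
        omega
    exact not_hasAdditiveReductionAt_quadraticTwist_pStar_of_good W r hr2 hDu hru (hgood r ⟨u, hu⟩)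
  have hf_m : ∀ r : Nat.Primes, ((r : ℕ) : ℤ) ∣ D → W'.conductorExponent ((primesEquiv (R := ℤ)).symm r) = 2 := fun r hr ↦
    TwistTypeConductor.conductorExponent_eq_two_of_twistType_odd W' r (hprime_m r hr).1 (hadd_m r hr) (fun _ ↦ hsemi_m r hr)
  have httW' : ∀ p : Nat.Primes, (p : ℕ) ≠ 2 → W'.HasAdditiveReductionAt ((primesEquiv (R := ℤ)).symm p) →
      ¬ (W'.quadraticTwist (((-1 : ℤ) ^ ((p : ℕ) / 2) * p : ℤ) : ℚ)).HasAdditiveReductionAt ((primesEquiv (R := ℤ)).symm p) := by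
    intro r hr2 ha'
    by_cases hrD : ((r : ℕ) : ℤ) ∣ D
    · exact hsemi_m r hrD
    · have ha : W.HasAdditiveReductionAt ((primesEquiv (R := ℤ)).symm r) := ((hred r hrD).2.2).mp ha'
      exact TwistRootNumberAnyTwo.twistType_quadraticTwist_of_not_dvd W htt D r hr2 (by rw [Rat.natGenerator_primesEquiv_symm]; exact hrD) ha
  have hle := TwistRootNumberAnyTwo.conductorExponent_pStar_le W htt
  have hle' := TwistRootNumberAnyTwo.conductorExponent_pStar_le W' httW'
  have hdvd_iff : ∀ (n : ℕ) (hn : n ≠ 0) (p : Nat.Primes), (p : ℕ) ∣ n ↔ n.factorization p ≠ 0 := fun n hn p ↦ by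
    rw [Ne, Nat.factorization_eq_zero_iff]; push Not; exact ⟨fun h ↦ ⟨p.2, h, hn⟩, fun h ↦ h.2.1⟩
  have hm_dvd_iff : ∀ r : Nat.Primes, (r : ℕ) ∣ D.natAbs ↔ ((r : ℕ) : ℤ) ∣ D := fun r ↦ Int.natCast_dvd.symm
  have hpf : N'.primeFactors = N.primeFactors ∪ D.natAbs.primeFactors := by
    ext r
    simp only [Finset.mem_union, Nat.mem_primeFactors]
    constructor
    · rintro ⟨hr, hrN', -⟩
      set R : Nat.Primes := ⟨r, hr⟩
      by_cases hrD : ((r : ℕ) : ℤ) ∣ D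
      · exact Or.inr ⟨hr, (hm_dvd_iff R).mpr hrD, hM0⟩
      · left
        refine ⟨hr, ?_, hN0⟩
        have h := (hdvd_iff N' hN'0 R).mp hrN'
        rw [show N'.factorization R = N'.factorization r from rfl, hfac_eq R hrD] at h
        exact (hdvd_iff N hN0 R).mpr h
    · rintro (⟨hr, hrN, -⟩ | ⟨hr, hrM, -⟩)
      · set R : Nat.Primes := ⟨r, hr⟩
        refine ⟨hr, ?_, hN'0⟩
        have hrD : ¬ ((r : ℕ) : ℤ) ∣ D := hbadN_not_dvd_D R hrN
        have h := (hdvd_iff N hN0 R).mp hrN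
        rw [← hfac_eq R hrD] at h
        exact (hdvd_iff N' hN'0 R).mpr h
      · set R : Nat.Primes := ⟨r, hr⟩
        refine ⟨hr, ?_, hN'0⟩
        exact (hdvd_iff N' hN'0 R).mpr (by rw [factorization_conductorNorm_primesEquiv_symm W' R, hf_m R ((hm_dvd_iff R).mp hrM)]; norm_num)
  have hdisj : Disjoint N.primeFactors D.natAbs.primeFactors := by
    rw [Finset.disjoint_left]
    intro r hrN hrM
    obtain ⟨hr, hrN', -⟩ := Nat.mem_primeFactors.mp hrN
    obtain ⟨-, hrM', -⟩ := Nat.mem_primeFactors.mp hrM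
    exact (hprime_m ⟨r, hr⟩ ((hm_dvd_iff ⟨r, hr⟩).mp hrM')).2 hrN'
  obtain ⟨f, hf⟩ := hmod W
  obtain ⟨f', hf'⟩ := hmod W'
  have hε := IsNewform0.frickeEigenvalue_eq_prod_atkinLehnerEigenvalueAt_holds hf.1
  have hε' := IsNewform0.frickeEigenvalue_eq_prod_atkinLehnerEigenvalueAt_holds hf'.1
  have hlam_m : ∀ r ∈ D.natAbs.primeFactors, atkinLehnerEigenvalueAt f' r = (ZMod.χ₄ r : ℂ) := by
    intro r hr
    obtain ⟨hrp, hrM, -⟩ := Nat.mem_primeFactors.mp hr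
    set R : Nat.Primes := ⟨r, hrp⟩
    have hrm : ((R : ℕ) : ℤ) ∣ D := (hm_dvd_iff R).mp hrM
    exact W'.atkinLehnerEigenvalueAt_eq_χ₄_of_twist_of_le hmod hf' R (hprime_m R hrm).1 (hadd_m R hrm) (hsemi_m R hrm)
      (hf_m R hrm) (hle' R (hprime_m R hrm).1)
  set jf : ℕ → ℤ := fun r ↦ if N.factorization r = 1 then (if r = 2 then ZMod.χ₈ (D : ZMod 8) else jacobiSym D r) else 1 with hjf
  have hlam_eq : ∀ r ∈ N.primeFactors, atkinLehnerEigenvalueAt f' r = (jf r : ℂ) * atkinLehnerEigenvalueAt f r := by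
    intro r hrN
    obtain ⟨hrp, hrdvd, -⟩ := Nat.mem_primeFactors.mp hrN
    set R : Nat.Primes := ⟨r, hrp⟩
    haveI := Fact.mk hrp
    have hrD : ¬ ((r : ℕ) : ℤ) ∣ D := hbadN_not_dvd_D R hrdvd
    have hbad : ¬ W.HasGoodReductionAt ((primesEquiv (R := ℤ)).symm R) := fun hg ↦ ((W.dvd_conductorNorm_iff_not_hasGoodReductionAtPrime r).mp hrdvd)
        ((W.hasGoodReductionAtPrime_iff_hasGoodReductionAt_holds R).mpr hg)
    rcases hasGoodReductionAt_or_hasMultiplicativeReductionAt_or_hasAdditiveReductionAt ((primesEquiv (R := ℤ)).symm R) W with h | hm | ha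
    · exact absurd h hbad
    · -- multiplicative: both are local root numbers; `r` is odd (if `r = 2`, `D ≡ 1 (mod 8)` is a square and nothing flips)
      have hf1 : W.conductorExponent ((primesEquiv (R := ℤ)).symm R) = 1 := (conductorExponent_eq_one_iff_holds _ W).mpr hm
      have hf1' : W'.conductorExponent ((primesEquiv (R := ℤ)).symm R) = 1 :=
        (conductorExponent_eq_one_iff_holds _ W').mpr (((hred R hrD).2.1).mpr hm)
      have hfac1 : N.factorization r = 1 := by
        rw [show N.factorization r = N.factorization R from rfl, factorization_conductorNorm_primesEquiv_symm W R, hf1]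
      have hrN' : r ∣ N' := (hdvd_iff N' hN'0 R).mpr (by rw [factorization_conductorNorm_primesEquiv_symm W' R, hf1']; norm_num)
      have hrrN' : ¬ r ^ 2 ∣ N' := by
        rw [hrp.pow_dvd_iff_le_factorization hN'0, show N'.factorization r = N'.factorization R from rfl,
          factorization_conductorNorm_primesEquiv_symm W' R, hf1']; omega
      have hrrN : ¬ r ^ 2 ∣ N := by
        rw [hrp.pow_dvd_iff_le_factorization hN0, show N.factorization r = N.factorization R from rfl,
          factorization_conductorNorm_primesEquiv_symm W R, hf1]; omega
      rw [W'.atkinLehnerEigenvalueAt_eq_localRootNumberAt_of_not_sq_dvd hf' R hrN' hrrN',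
        W.atkinLehnerEigenvalueAt_eq_localRootNumberAt_of_not_sq_dvd hf R hrdvd hrrN]
      simp only [hjf, hfac1, if_true]
      by_cases hr2 : r = 2
      · -- `r = 2` (multiplicative): `w₂(E^{(D)}) = χ₈(D)·w₂(E)` (the split type flips iff `D ≡ 5 (8)`, p812548)
        have hRP : R = P2 := Subtype.ext hr2
        simp only [hr2, if_true]
        rw [hRP] at hm ⊢
        rw [hW', localRootNumberAt_two_quadraticTwist_eq_χ₈_mul W hD4 hm]
        push_cast; ring
      · simp only [hr2, if_false]
        rcases jacobiSym.eq_one_or_neg_one (a := D) (b := r) (by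
            rw [Int.gcd_eq_natAbs, Int.natAbs_natCast]
            exact Nat.Coprime.symm ((Nat.Prime.coprime_iff_not_dvd hrp).mpr fun h ↦ hrD (Int.natCast_dvd.mpr h))) with hj | hj
        · -- square: the curves are isomorphic over `ℚ_r`
          rw [W.localRootNumberAt_quadraticTwist_of_isSquare R hD0 (isSquare_padic_of_jacobiSym_eq_one hr2 hj), hj]
          push_cast; ring
        · -- non-square unit at a multiplicative prime: split and non-split are swapped, the local root number flips
          obtain ⟨w, hw⟩ : ∃ w : HeightOneSpectrum (𝓞 ℚ), (primesEquiv w : ℕ) = r := ⟨(primesEquiv (R := 𝓞 ℚ)).symm R, by simp [R]⟩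
          have hmQ : W.HasMultiplicativeReductionAtPrime r := (W.hasMultiplicativeReductionAtPrime_iff_hasMultiplicativeReductionAt_holds R).mpr hm
          have hmQ' : W'.HasMultiplicativeReductionAtPrime r :=
            (W'.hasMultiplicativeReductionAtPrime_iff_hasMultiplicativeReductionAt_holds R).mpr (((hred R hrD).2.1).mpr hm)
          have hm_w : W.HasMultiplicativeReductionAt w := (hasMultiplicativeReductionAtPrime_primesEquiv_iff_holds W w r hw).mp hmQ
          have hw2 : (primesEquiv w : ℕ) ≠ 2 := by rw [hw]; exact hr2
          have hwD : ¬ ((primesEquiv w : ℕ) : ℤ) ∣ D := by rw [hw]; exact hrD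
          obtain ⟨-, -, key⟩ := AdditivePotMult.hasMultiplicativeReductionAt_and_split_iff_quadraticTwist_of_not_dvd W w hw2 hwD hm_w
          have hnsq : ¬ IsSquare ((D : ℤ) : ZMod (primesEquiv w : ℕ)) := by
            rw [hw]; exact ZMod.nonsquare_of_jacobiSym_eq_neg_one hj
          have e1 : W'.HasSplitMultiplicativeReductionAt w ↔ W'.HasSplitMultiplicativeReductionAtPrime r := by
            rw [← W'.hasSplitMultiplicativeReductionAtPrime_iff_hasSplitMultiplicativeReductionAt w]; subst hw; rfl
          have e2 : W.HasSplitMultiplicativeReductionAt w ↔ W.HasSplitMultiplicativeReductionAtPrime r := by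
            rw [← W.hasSplitMultiplicativeReductionAtPrime_iff_hasSplitMultiplicativeReductionAt w]; subst hw; rfl
          rw [hW'] at e1
          rw [e1, e2] at key
          have hflip : (W.quadraticTwist (D : ℚ)).HasSplitMultiplicativeReductionAtPrime r ↔ ¬ W.HasSplitMultiplicativeReductionAtPrime r := by
            rw [key]; constructor
            · intro h hs; exact hnsq (h.mpr hs)
            · intro h; exact ⟨fun hsq ↦ absurd hsq hnsq, fun hs ↦ absurd hs h⟩
          rw [localRootNumberAt_primesEquiv_symm_eq, localRootNumberAt_primesEquiv_symm_eq, hj]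
          by_cases hs : W.HasSplitMultiplicativeReductionAtPrime r
          · have hns' : ¬ W'.HasSplitMultiplicativeReductionAtPrime r := by rw [hW']; exact fun h ↦ (hflip.mp h) hs
            rw [localRootNumber_of_hasMultiplicativeReduction _ _ hmQ' hns', localRootNumber_of_hasSplitMultiplicativeReduction _ _ hs]
            push_cast; ring
          · have hs' : W'.HasSplitMultiplicativeReductionAtPrime r := by rw [hW']; exact hflip.mpr hs
            rw [localRootNumber_of_hasSplitMultiplicativeReduction _ _ hs', localRootNumber_of_hasMultiplicativeReduction _ _ hmQ hs]
            push_cast; ring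
    · -- additive: the level keeps `r` to an exponent `≥ 2`, so the engine's factor is `1`
      have hfac2 : N.factorization r ≠ 1 := by
        rw [show N.factorization r = N.factorization R from rfl, factorization_conductorNorm_primesEquiv_symm W R]
        have := (two_le_conductorExponent_iff_holds ((primesEquiv (R := ℤ)).symm R) W).mpr ha; omega
      by_cases hr2 : r = 2
      · -- `r = 2`, twist type with parameter `t`: `λ₂(f') = λ₂(f) = χ_t(−1)` (LEAD g18, Atkin–Li via p814752)
        have hRP : R = P2 := Subtype.ext hr2
        rw [hRP] at ha
        obtain ⟨t, ht, hnt⟩ := h2tt P2 rfl ha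
        have hkey := atkinLehnerEigenvalueAt_two_quadraticTwist_eq_of_twistType_two W hmod ht ha hnt hD4 hf rfl hf' (by rw [hW'])
        simp only [hjf, if_neg hfac2]
        rw [hr2, hkey]
        push_cast; ring
      have hsemi := htt R hr2 ha
      have ha' : W'.HasAdditiveReductionAt ((primesEquiv (R := ℤ)).symm R) := ((hred R hrD).2.2).mpr ha
      have hsemi' := httW' R hr2 ha'
      rw [W'.atkinLehnerEigenvalueAt_eq_χ₄_of_twist_of_le hmod hf' R hr2 ha' hsemi'
          (TwistTypeConductor.conductorExponent_eq_two_of_twistType_odd W' R hr2 ha' (fun _ ↦ hsemi')) (hle' R hr2),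
        W.atkinLehnerEigenvalueAt_eq_χ₄_of_twist_of_le hmod hf R hr2 ha hsemi
          (TwistTypeConductor.conductorExponent_eq_two_of_twistType_odd W R hr2 ha (fun _ ↦ hsemi)) (hle R hr2)]
      simp only [hjf, if_neg hfac2]
      push_cast; ring
  have hP : ∏ r ∈ N.primeFactors, atkinLehnerEigenvalueAt f' r =
      (∏ r ∈ N.primeFactors, (jf r : ℂ)) * ∏ r ∈ N.primeFactors, atkinLehnerEigenvalueAt f r := by
    rw [Finset.prod_congr rfl hlam_eq, Finset.prod_mul_distrib]
  have hPm' : ∏ r ∈ D.natAbs.primeFactors, ZMod.χ₄ (r : ZMod 4) = ZMod.χ₄ (D.natAbs : ZMod 4) := by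
    conv_rhs => rw [← Nat.prod_primeFactors_of_squarefree hMsq, Nat.cast_prod, map_prod]
  have hPm : ∏ r ∈ D.natAbs.primeFactors, atkinLehnerEigenvalueAt f' r = (ZMod.χ₄ (D.natAbs : ZMod 4) : ℂ) := by
    rw [Finset.prod_congr rfl hlam_m]
    exact_mod_cast congrArg (fun z : ℤ ↦ (z : ℂ)) hPm'
  have hεeq : frickeEigenvalue f' = (ZMod.χ₄ (D.natAbs : ZMod 4) : ℂ) * (∏ r ∈ N.primeFactors, (jf r : ℂ)) * frickeEigenvalue f := by
    rw [hε', hε, hpf, Finset.prod_union hdisj, hP, hPm]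
    ring
  have hw' := rootNumber_eq_neg_frickeEigenvalue (W := W') (fun _ _ ↦ IsNewform0.exists_functional_equation_holds)
    (fun _ _ ↦ IsNewform0.frickeEigenvalue_eq_one_or_eq_neg_one_holds) hf'
  have hw := rootNumber_eq_neg_frickeEigenvalue (W := W) (fun _ _ ↦ IsNewform0.exists_functional_equation_holds)
    (fun _ _ ↦ IsNewform0.frickeEigenvalue_eq_one_or_eq_neg_one_holds) hf
  have hwf : frickeEigenvalue f = -((W.rootNumber : ℤ) : ℂ) := by rw [hw]; ring
  have h : ((W'.rootNumber : ℤ) : ℂ) =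
      ((ZMod.χ₄ (D.natAbs : ZMod 4) : ℤ) : ℂ) * ((∏ r ∈ N.primeFactors, jf r : ℤ) : ℂ) * ((W.rootNumber : ℤ) : ℂ) := by
    rw [hw', hεeq, hwf]; push_cast; ring
  exact_mod_cast h

end Summit.BirchSwinnertonDyer.BirchSwinnertonDyer.Theorems.TwistRootNumberTwisted

end
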